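import Literature.IUT.LogVolume.TensorPacketContentSharp
import Literature.IUT.LogVolume.TensorPacketLogStar
import HarnessLib

/-!
# The SHARP UPPER end of the (Ind2)-orbit-hull volume: [IUTchIV] Prop. 1.2 (ii) with Prop. 1.1's exponent
# `d_{I✱} = d_I − d_✱` instead of `d_I` (Dupuy–Hilado §4.9–4.12; [IUTchIV] Thm. 1.10 Step (v))

abc-iut cell, seat abc-iut-w6-d018 (R2 TARGET #1 «Rest_lower», the companion upper side «PROP12II-SHARP-UPPER»).
abc-iut-w5-d180/w5-d082's `TensorPacketContentBounds` / `TensorPacketContentVolume` bound the content `m` of a region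
`M ⊆ ⋃_i ι_i(g_i)·(R_I)^∼` BELOW through [IUTchIV] Prop. 1.2 (ii) `ι_i(g)·(R_I)^∼ ⊆ p^{⌊λ − d_I − a_I⌋}·log_p(R_I^×)` (abc-iut-S6's
`prop12ii_holds`), whose `d_I` comes from the ALL-`δ` form `(⊗_i δ_i)·(R_I)^∼ ⊆ R_I` of Prop. 1.1. Prop. 1.1 as printed (and
as discharged by abc-iut-S5, `PacketDifferent.purePacket_mul_mem_integerPacket`) is SHARPER: `(⊗_{i≠✱} δ_i)·(R_I)^∼ ⊆ R_I`
for any slot `✱`, exponent `d_{I✱} = d_I − d_✱`; abc-iut-w4-d006 carried it through Prop. 1.2 (ii)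
(`TensorPacketLogStar.iota_smul_normalizedPacket_subset_zpow_smul_logPacket_of_star`:
`ι_i(g)·(R_I)^∼ ⊆ p^{⌊λ − (d_I − d_✱) − a_I⌋}·log_p(R_I^×)` for EVERY slot `✱`). HERE that exponent is carried through the
Step (v) VOLUME bound of the (Ind2)-orbit hull:

* `content_ge_star` — a bounded `M ⊄ p^{m+1}·Λ` inside `⋃_i ι_i(g_i)·(R_I)^∼` has `⌊λ_min − (d_I − d_✱) − a_I⌋ ≤ m`;
* **`packetLogμ_packetHull_orbit_le_star`** — `log μ̄(hull(⋃_γ γ·M)) ≤ −⌊λ_min − (d_I − d_✱) − a_I⌋·log p + H`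
  (`H = log μ̄(hull(Λ))`), and `packetLogμ_packetHull_orbit_le_star'` — `≤ (−λ_min + d_I − d_✱ + a_I + b_I + 1)·log p`
  (`H ≤ b_I·log p`, w5-d082). With `✱` a slot of LARGEST different: against the sharp lower end
  `log‖g‖ + (d_I − min_J d_{L_J})·log p` (`packetLogμ_packetHull_orbit_ge_sharp`) the undecided band at a summand is
  `{min_J d_{L_J} − max_j d_j + a_I + b_I + 1}·log p` — for a packet of EQUAL slots (`min_J d_{L_J} = d`,
  `TensorPacketFactorDifferentMin.inf_differentOrd_dFac_eq_of_algEquiv`) exactly the tame constants `{a_I + b_I + 1}·log p`: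
  the content of every diagonal capsule is pinned to within `a_I + b_I + 2`.
Classical; the tags record the cell's typing of [IUTchIV] §1. [cite: Mochizuki2012, IUTchIV Prop. 1.1 p. 9, Prop. 1.2 (ii)
p. 10–11, Thm. 1.10 Step (v) p. 27–28] [cite: DupuyHilado2025, §4.9, §4.12] No side taken on [IUTchIII] Cor. 3.12
[claim: Mochizuki2012, status: disputed]. PROOF-ONLY file: no definitions, no named `Prop` facts.
-/

noncomputable section

open Set Module Function
open scoped Pointwise TensorProduct NormedField

namespace Literature.IUT.LogVolume

section Upper

variable (p : ℕ) [Fact p.Prime]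
variable {I : Type} [Fintype I] [DecidableEq I] [Nonempty I]
variable (k : I → Type) [∀ i, NontriviallyNormedField (k i)] [∀ i, NormedAlgebra ℚ_[p] (k i)]
  [∀ i, IsUltrametricDist (k i)] [∀ i, ProperSpace (k i)]

/-- **Content lower bound, ✱-form**: if `M ⊄ p^{m+1}·log_p(R_I^×)` while `M ⊆ ⋃_i ι_i(g_i)·(R_I)^∼` (`‖g_i‖ = p^{−m_i/e_i}`,
`i₀` of least order `λ_min`), then `⌊λ_min − (d_I − d_✱) − a_I⌋ ≤ m` for every slot `✱`.
[cite: Mochizuki2012, IUTchIV Prop. 1.2 (ii) p. 10] -/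
theorem content_ge_star (star : I) {M : Set (PacketAlgebra p k)} {m : ℤ}
    (hM1 : ¬ M ⊆ ((p : ℚ_[p]) ^ (m + 1)) • (logPacket p k : Set (PacketAlgebra p k)))
    (g : Π i, k i) (mexp : I → ℤ) (hg : ∀ i, ‖g i‖ = (p : ℝ) ^ (-((mexp i : ℝ) / absRamificationIdx p (k i))))
    (i₀ : I) (hmin : ∀ i, (mexp i₀ : ℝ) / absRamificationIdx p (k i₀) ≤ (mexp i : ℝ) / absRamificationIdx p (k i))
    (hMU : M ⊆ ⋃ i, iota p k i (g i) • (normalizedPacket p k : Set (PacketAlgebra p k))) :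
    ⌊(mexp i₀ : ℝ) / absRamificationIdx p (k i₀) - (dSum p k - differentOrd p (k star)) - aSum p k⌋ ≤ m := by
  set n₀ : ℤ := ⌊(mexp i₀ : ℝ) / absRamificationIdx p (k i₀) - (dSum p k - differentOrd p (k star)) - aSum p k⌋
    with hn₀
  have hMn : M ⊆ ((p : ℚ_[p]) ^ n₀) • (logPacket p k : Set (PacketAlgebra p k)) := by
    refine hMU.trans (Set.iUnion_subset fun i => ?_)
    refine (iota_smul_normalizedPacket_subset_zpow_smul_logPacket_of_star p k star i (hg i)).trans
      (zpow_smul_logPacket_anti p k ?_)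
    exact Int.floor_le_floor (by linarith [hmin i])
  by_contra hlt
  rw [not_le] at hlt
  exact hM1 (hMn.trans (zpow_smul_logPacket_anti p k (by omega)))

/-- **SHARP UPPER END OF THE ORBIT-HULL VOLUME (✱-form of the Step (v) route)**: for a bounded region `M ⊄ {0}` inside
`⋃_i ι_i(g_i)·(R_I)^∼` (`i₀` of least order `λ_min`) and every slot `✱`,
`log μ̄(hull(⋃_{γ∈Ind2} γ·M)) ≤ −⌊λ_min − (d_I − d_✱) − a_I⌋·log p + log μ̄(hull(log_p(R_I^×)))`.
[cite: Mochizuki2012, IUTchIV Thm. 1.10 Step (v) p. 27–28] [cite: DupuyHilado2025, §4.9, §4.12] -/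
theorem packetLogμ_packetHull_orbit_le_star (star : I) {M : Set (PacketAlgebra p k)}
    (hMb : IsPsiBounded p k M) (hM0 : ∃ x ∈ M, x ≠ 0)
    (g : Π i, k i) (mexp : I → ℤ) (hg : ∀ i, ‖g i‖ = (p : ℝ) ^ (-((mexp i : ℝ) / absRamificationIdx p (k i))))
    (i₀ : I) (hmin : ∀ i, (mexp i₀ : ℝ) / absRamificationIdx p (k i₀) ≤ (mexp i : ℝ) / absRamificationIdx p (k i))
    (hMU : M ⊆ ⋃ i, iota p k i (g i) • (normalizedPacket p k : Set (PacketAlgebra p k))) :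
    packetLogμ p k (packetHull p k (⋃ γ : indTwo p k, γ • M)) ≤
      -(⌊(mexp i₀ : ℝ) / absRamificationIdx p (k i₀) - (dSum p k - differentOrd p (k star)) - aSum p k⌋ * Real.log p) +
        packetLogμ p k (packetHull p k (logPacket p k : Set (PacketAlgebra p k))) := by
  obtain ⟨m, -, hm1, -, hvol⟩ := exists_packetLogμ_packetHull_orbit_eq p k hMb hM0
  have hc := content_ge_star p k star hm1 g mexp hg i₀ hmin hMU
  have hlogp : 0 ≤ Real.log p := Real.log_nonneg (by exact_mod_cast (Fact.out : p.Prime).one_lt.le)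
  have hc' : (⌊(mexp i₀ : ℝ) / absRamificationIdx p (k i₀) - (dSum p k - differentOrd p (k star)) - aSum p k⌋ : ℝ)
      ≤ m := by exact_mod_cast hc
  rw [hvol]
  nlinarith

/-- **SHARP UPPER END, coarse closed form**: `log μ̄(hull(⋃_γ γ·M)) ≤ (−λ_min + d_I − d_✱ + a_I + b_I + 1)·log p`
(`⌊x⌋ > x − 1` and `log μ̄(hull(log_p(R_I^×))) ≤ b_I·log p`). Against the sharp lower end `log‖g_{i₀}‖ + (d_I − min_J
d_{L_J})·log p` the undecided band at a summand is `{min_J d_{L_J} − d_✱ + a_I + b_I + 1}·log p` — the tame constants only,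
once `✱` is a slot of largest different and the slots are equal. [cite: Mochizuki2012, IUTchIV Thm. 1.10 Step (v) p. 27–28] -/
theorem packetLogμ_packetHull_orbit_le_star' (star : I) {M : Set (PacketAlgebra p k)}
    (hMb : IsPsiBounded p k M) (hM0 : ∃ x ∈ M, x ≠ 0)
    (g : Π i, k i) (mexp : I → ℤ) (hg : ∀ i, ‖g i‖ = (p : ℝ) ^ (-((mexp i : ℝ) / absRamificationIdx p (k i))))
    (i₀ : I) (hmin : ∀ i, (mexp i₀ : ℝ) / absRamificationIdx p (k i₀) ≤ (mexp i : ℝ) / absRamificationIdx p (k i))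
    (hMU : M ⊆ ⋃ i, iota p k i (g i) • (normalizedPacket p k : Set (PacketAlgebra p k))) :
    packetLogμ p k (packetHull p k (⋃ γ : indTwo p k, γ • M)) ≤
      (-((mexp i₀ : ℝ) / absRamificationIdx p (k i₀)) + (dSum p k - differentOrd p (k star)) + aSum p k + bSum p k + 1)
        * Real.log p := by
  have h1 := packetLogμ_packetHull_orbit_le_star p k star hMb hM0 g mexp hg i₀ hmin hMU
  have hH := packetLogμ_packetHull_logPacket_le_bSum p k
  have hlogp : 0 ≤ Real.log p := Real.log_nonneg (by exact_mod_cast (Fact.out : p.Prime).one_lt.le)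
  have hfl := Int.lt_floor_add_one
    ((mexp i₀ : ℝ) / absRamificationIdx p (k i₀) - (dSum p k - differentOrd p (k star)) - aSum p k)
  nlinarith

end Upper

end Literature.IUT.LogVolume

end
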